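import Mathlib
import Literature.NumberTheory.Transcendental.RoyCriterion
import Literature.NumberTheory.Transcendental.PhilipponZeroEstimateHolds
import Literature.NumberTheory.Transcendental.PhilipponZeroEstimateOrder
import Literature.NumberTheory.Transcendental.PhilipponZeroEstimateProofs
import Literature.NumberTheory.Transcendental.TwoLogarithmsZeroLemma
import HarnessLib

/-!
# Philippon's zero estimate on `𝔾ₐ × 𝔾ₘ` along Roy's direction (solo-Schanuel-blind)

Roy's Conjecture 2 [Roy2001] (`RoyCriterion l`, equivalent to Schanuel's conjecture for rank `l`)
works on the group `G = 𝔾ₐ × 𝔾ₘ` with the derivation `D = ∂/∂X₀ + X₁∂/∂X₁`, i.e. the invariant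
derivation `D_{w₀}` of the direction `w₀ = (1, 1) ∈ Lie G` (`map_royD`). This file specialises the
tree's PROVED zero estimate with multiplicities `Philippon1986_GaGm_holds` (Philippon 1986 BSMF,
Thm 2.1; Roy, LNM 1752 Ch. 11 Thm 4.1) to `m = 1` and `W = ℂ w₀` and puts it in the clean form
used by the companion file `SoloBlindOrbitCommonZeros.lean` (Lemma CZ: the common zeros of Roy's
orbit family are torsion points):

* `philippon_GaGm_one` — there is an absolute `c` such that a non-zero `P ∈ ℂ[X, Y]` of bidegree
  `≤ (D₀, D₁)` vanishing to order `≥ 2T+1` along `exp(ℂ w₀)` on `Σ·Σ` (`Σ ∋ e` finite) has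
  `T + 1 ≤ c D₀` or `T + 1 ≤ c D₁` or `(T+1)·card Σ ≤ c D₀ D₁`. The connected algebraic
  subgroups of `𝔾ₐ × 𝔾ₘ` are `{e}, G, 𝔾ₐ × 1, 0 × 𝔾ₘ` (a saturated subgroup of `ℤ¹` is `0` or
  `ℤ¹`, `TwoLog.chars_eq_bot_or_top`); `w₀` is transverse to the Lie algebras of both middle ones,
  and `G' = G` is excluded by `P ≠ 0`;
* `vanishesToOrder_royLine_of`, `map_royD_iterate`, `evalAt_map_int` — the dictionary from Roy's
  data `(D^k P)(g) = 0, k < N` (`P ∈ ℤ[X₀,X₁]`, `royD`) to `VanishesToOrder P (ℂ w₀) g N`.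

The multiplicity-free case along no direction (`T = 0`) is the tree's two-logarithms zero lemma
`TwoLog.eq_zero_of_vanish`; the present form keeps Philippon's multiplicities `T` along `w₀`, which
is what Roy's data (`k ≤ N^{s₀}` derivatives) provide.

References: D. Roy, *An arithmetic criterion for the values of the exponential function*, Acta
Arith. 97 (2001) [Roy2001]; P. Philippon, *Lemmes de zéros dans les groupes algébriques
commutatifs*, BSMF 114 (1986), Thm 2.1 [Philippon1986]; Yu. Nesterenko, P. Philippon (eds.),
LNM 1752 (2001), Ch. 11 (D. Roy), Thm 4.1.
-/

noncomputable section

namespace Summit.Schanuel.Schanuel.Theorems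

open Literature.NumberTheory.Transcendental GaGm MvPolynomial

/-! ### Connected algebraic subgroups of `𝔾ₐ × 𝔾ₘ` -/

/-- No additive part and all characters: `G' = {e}`. -/
theorem connAlgSubgroup_one_eq_bot (H : ConnAlgSubgroup 1) (hc : H.chars = ⊤)
    (ha : H.addPart = false) : H = ConnAlgSubgroup.bot 1 := by
  obtain ⟨ap, ch, sat⟩ := H
  change ch = ⊤ at hc
  change ap = false at ha
  subst hc
  subst ha
  rfl

/-- Additive part and no characters: `G' = G`. -/
theorem connAlgSubgroup_one_eq_top (H : ConnAlgSubgroup 1) (hc : H.chars = ⊥)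
    (ha : H.addPart = true) : H = ConnAlgSubgroup.top 1 := by
  obtain ⟨ap, ch, sat⟩ := H
  change ch = ⊥ at hc
  change ap = true at ha
  subst hc
  subst ha
  rfl

/-- All characters: the torus part has zero Lie algebra. -/
theorem torusTangent_eq_bot_of_chars_eq_top (H : ConnAlgSubgroup 1) (hc : H.chars = ⊤) :
    H.torusTangent = ⊥ := by
  refine (Submodule.eq_bot_iff _).mpr fun v hv => ?_
  funext j
  have h : ∑ i, ((Pi.single j 1 : Fin 1 → ℤ) i : ℂ) * v i = 0 :=
    hv (Pi.single j 1) (by rw [hc]; exact AddSubgroup.mem_top _)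
  rw [Finset.sum_eq_single j (fun b _ hb => by simp [Pi.single_eq_of_ne hb])
    (fun hj => absurd (Finset.mem_univ j) hj)] at h
  simpa using h

/-- No characters: the torus part has Lie algebra `ℂ¹`. -/
theorem torusTangent_eq_top_of_chars_eq_bot (H : ConnAlgSubgroup 1) (hc : H.chars = ⊥) :
    H.torusTangent = ⊤ := by
  refine Submodule.eq_top_iff'.mpr fun v χ hχ => ?_
  rw [hc, AddSubgroup.mem_bot] at hχ
  simp [hχ]

/-! ### Roy's direction `w₀ = (1,1)` and the line `W = ℂ w₀` -/

/-- `w₀ ≠ 0`. -/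
theorem royDir_ne_zero : (((1 : ℂ), (1 : Fin 1 → ℂ)) : ℂ × (Fin 1 → ℂ)) ≠ 0 := by
  intro h
  have := congrArg Prod.fst h
  simp at this

/-- `dim W = 1`. -/
theorem finrank_royLine : Module.finrank ℂ (ℂ ∙ ((1 : ℂ), (1 : Fin 1 → ℂ))) = 1 :=
  finrank_span_singleton royDir_ne_zero

/-- Elements of `W` are the multiples `a w₀`. -/
theorem mem_royLine {v : ℂ × (Fin 1 → ℂ)} :
    v ∈ (ℂ ∙ ((1 : ℂ), (1 : Fin 1 → ℂ))) ↔ ∃ a : ℂ, a • ((1 : ℂ), (1 : Fin 1 → ℂ)) = v :=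
  Submodule.mem_span_singleton

/-- `W` is transverse to `Lie(V × 1)` for any `V`. -/
theorem royLine_inf_prod_bot (V : Submodule ℂ ℂ) :
    (ℂ ∙ ((1 : ℂ), (1 : Fin 1 → ℂ))) ⊓ V.prod (⊥ : Submodule ℂ (Fin 1 → ℂ)) = ⊥ := by
  rw [Submodule.eq_bot_iff]
  rintro v ⟨hv, hv'⟩
  obtain ⟨a, rfl⟩ := mem_royLine.mp hv
  have h2 : (a • ((1 : ℂ), (1 : Fin 1 → ℂ))).2 ∈ (⊥ : Submodule ℂ (Fin 1 → ℂ)) :=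
    (Submodule.mem_prod.mp hv').2
  rw [Submodule.mem_bot] at h2
  have ha : a = 0 := by
    have := congrFun h2 0
    simpa using this
  simp [ha]

/-- `W` is transverse to `Lie(0 × T)` for any `T`. -/
theorem royLine_inf_bot_prod (V : Submodule ℂ (Fin 1 → ℂ)) :
    (ℂ ∙ ((1 : ℂ), (1 : Fin 1 → ℂ))) ⊓ (⊥ : Submodule ℂ ℂ).prod V = ⊥ := by
  rw [Submodule.eq_bot_iff]
  rintro v ⟨hv, hv'⟩
  obtain ⟨a, rfl⟩ := mem_royLine.mp hv
  have h1 : (a • ((1 : ℂ), (1 : Fin 1 → ℂ))).1 ∈ (⊥ : Submodule ℂ ℂ) :=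
    (Submodule.mem_prod.mp hv').1
  rw [Submodule.mem_bot] at h1
  have ha : a = 0 := by simpa using h1
  simp [ha]

/-- In the quotient by the trivial subgroup nothing is identified. -/
theorem ncard_image_mk_bot (S : Set (GaGm 1)) :
    ((QuotientGroup.mk : GaGm 1 → GaGm 1 ⧸ (ConnAlgSubgroup.bot 1).toSubgroup) '' S).ncard =
      S.ncard := by
  apply Set.ncard_image_of_injective
  intro a b hab
  have h := QuotientGroup.eq.mp hab
  rw [ConnAlgSubgroup.mem_toSubgroup_bot_iff] at h
  exact inv_mul_eq_one.mp h

/-! ### Philippon's zero estimate on `𝔾ₐ × 𝔾ₘ` along Roy's direction, in clean form -/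

/-- **Philippon's zero estimate for `𝔾ₐ × 𝔾ₘ` along `w₀ = (1,1)`** (from the tree's
`Philippon1986_GaGm_holds`, `m = 1`): there is an absolute constant `c` such that a non-zero
`P ∈ ℂ[X, Y]` of bidegree `≤ (D₀, D₁)` (`D₀, D₁ ≥ 1`) vanishing to order `≥ 2T + 1` along
`exp(ℂ w₀)` at every point of `Σ·Σ`, `Σ ∋ e` finite, satisfies
`T + 1 ≤ c D₀` or `T + 1 ≤ c D₁` or `(T + 1) · card Σ ≤ c D₀ D₁`
(the obstruction subgroup is `0 × 𝔾ₘ`, `𝔾ₐ × 1` or `{e}`; it is never `G` since `P ≠ 0`). -/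
theorem philippon_GaGm_one :
    ∃ c : ℕ, ∀ (D₀ D₁ T : ℕ) (S : Set (GaGm 1)) (P : MvPolynomial (Fin 2) ℂ),
      1 ≤ D₀ → 1 ≤ D₁ → S.Finite → (1 : GaGm 1) ∈ S → P ≠ 0 →
      P.degreeOf 0 ≤ D₀ → P.degreeOf 1 ≤ D₁ →
      (∀ g ∈ sumset S 2, VanishesToOrder P (ℂ ∙ ((1 : ℂ), (1 : Fin 1 → ℂ))) g (2 * T + 1)) →
      T + 1 ≤ c * D₀ ∨ T + 1 ≤ c * D₁ ∨ (T + 1) * S.ncard ≤ c * D₀ * D₁ := by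
  obtain ⟨c, hc⟩ := Philippon1986_GaGm_holds 1
  refine ⟨c, fun D₀ D₁ T S P hD₀ hD₁ hS h1 hP hdeg0 hdeg1 hvan => ?_⟩
  have hdeg1' : ∀ s ∈ P.support, ∑ j : Fin 1, s (Fin.succ j) ≤ D₁ := by
    intro s hs
    rw [Fin.sum_univ_one]
    exact degreeOf_le_iff.mp hdeg1 s hs
  have hW : 0 < Module.finrank ℂ (ℂ ∙ ((1 : ℂ), (1 : Fin 1 → ℂ))) := by
    rw [finrank_royLine]
    exact Nat.one_pos
  have hvan' : ∀ g ∈ sumset S (1 + 1),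
      VanishesToOrder P (ℂ ∙ ((1 : ℂ), (1 : Fin 1 → ℂ))) g ((1 + 1) * T + 1) :=
    fun g hg => by simpa [two_mul] using hvan g hg
  obtain ⟨H, ⟨g, hg⟩, hineq⟩ :=
    hc D₀ D₁ T (ℂ ∙ ((1 : ℂ), (1 : Fin 1 → ℂ))) S P hD₀ hD₁ hW hS h1 hP hdeg0 hdeg1' hvan'
  rcases TwoLog.chars_eq_bot_or_top H with hch | hch
  · -- no characters: the torus part is `𝔾ₘ`
    by_cases ha : H.addPart = true
    · -- `G' = G` is impossible for `P ≠ 0`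
      have htop := connAlgSubgroup_one_eq_top H hch ha
      subst htop
      exact absurd (eq_zero_of_forall_evalAt_mul hg) hP
    · -- `G' = 0 × 𝔾ₘ`
      simp only [Bool.not_eq_true] at ha
      left
      have htan : H.tangent = (⊥ : Submodule ℂ ℂ).prod ⊤ := by
        rw [ConnAlgSubgroup.tangent, torusTangent_eq_top_of_chars_eq_bot H hch]
        simp [ha]
      have e1 : Module.finrank ℂ ↥((ℂ ∙ ((1 : ℂ), (1 : Fin 1 → ℂ))) ⊓ H.tangent) = 0 := by
        rw [htan, royLine_inf_bot_prod]
        exact finrank_bot ℂ _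
      have e2 : H.addDim = 0 := by simp [ConnAlgSubgroup.addDim, ha]
      have e3 : H.torusDim = 1 := TwoLog.torusDim_eq_one_of_chars_eq_bot H hch
      rw [e1, finrank_royLine, e2, e3] at hineq
      simp only [Nat.sub_zero, Nat.choose_one_right, pow_one, pow_zero, mul_one] at hineq
      have hk : 0 < ((QuotientGroup.mk : GaGm 1 → GaGm 1 ⧸ H.toSubgroup) '' S).ncard :=
        (Set.ncard_pos (hS.image _)).mpr ((Set.nonempty_of_mem h1).image _)
      have h3 : (T + 1) * D₁ ≤ (c * D₀) * D₁ :=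
        calc (T + 1) * D₁
            ≤ (T + 1) * ((QuotientGroup.mk : GaGm 1 → GaGm 1 ⧸ H.toSubgroup) '' S).ncard * D₁ :=
              Nat.mul_le_mul_right _ (Nat.le_mul_of_pos_right _ hk)
          _ ≤ c * D₀ * D₁ := hineq
          _ = (c * D₀) * D₁ := by ring
      exact Nat.le_of_mul_le_mul_right h3 hD₁
  · -- all characters: the torus part is trivial
    by_cases ha : H.addPart = true
    · -- `G' = 𝔾ₐ × 1`
      right; left
      have htan : H.tangent = (⊤ : Submodule ℂ ℂ).prod ⊥ := by
        rw [ConnAlgSubgroup.tangent, torusTangent_eq_bot_of_chars_eq_top H hch]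
        simp [ha]
      have e1 : Module.finrank ℂ ↥((ℂ ∙ ((1 : ℂ), (1 : Fin 1 → ℂ))) ⊓ H.tangent) = 0 := by
        rw [htan, royLine_inf_prod_bot]
        exact finrank_bot ℂ _
      have e2 : H.addDim = 1 := by simp [ConnAlgSubgroup.addDim, ha]
      have e3 : H.torusDim = 0 := by
        rw [ConnAlgSubgroup.torusDim, torusTangent_eq_bot_of_chars_eq_top H hch]
        exact finrank_bot ℂ (Fin 1 → ℂ)
      rw [e1, finrank_royLine, e2, e3] at hineq
      simp only [Nat.sub_zero, Nat.choose_one_right, pow_one, pow_zero, mul_one] at hineq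
      have hk : 0 < ((QuotientGroup.mk : GaGm 1 → GaGm 1 ⧸ H.toSubgroup) '' S).ncard :=
        (Set.ncard_pos (hS.image _)).mpr ((Set.nonempty_of_mem h1).image _)
      have h3 : (T + 1) * D₀ ≤ (c * D₁) * D₀ :=
        calc (T + 1) * D₀
            ≤ (T + 1) * ((QuotientGroup.mk : GaGm 1 → GaGm 1 ⧸ H.toSubgroup) '' S).ncard * D₀ :=
              Nat.mul_le_mul_right _ (Nat.le_mul_of_pos_right _ hk)
          _ ≤ c * D₀ * D₁ := hineq
          _ = (c * D₁) * D₀ := by ring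
      exact Nat.le_of_mul_le_mul_right h3 hD₀
    · -- `G' = {e}`
      simp only [Bool.not_eq_true] at ha
      right; right
      have hbot := connAlgSubgroup_one_eq_bot H hch ha
      subst hbot
      have e1 : Module.finrank ℂ
          ↥((ℂ ∙ ((1 : ℂ), (1 : Fin 1 → ℂ))) ⊓ (ConnAlgSubgroup.bot 1).tangent) = 0 := by
        rw [ConnAlgSubgroup.tangent_bot, inf_bot_eq]
        exact finrank_bot ℂ _
      rw [e1, finrank_royLine, ncard_image_mk_bot, ConnAlgSubgroup.addDim_bot,
        ConnAlgSubgroup.torusDim_bot] at hineq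
      simpa [Nat.choose_one_right] using hineq

/-! ### Roy's derivation and the order of vanishing along `W` -/

/-- Iterates of a `ℂ`-derivation are `ℂ`-homogeneous. -/
theorem derivation_iterate_smul {A : Type*} [CommRing A] [Algebra ℂ A] (D : Derivation ℂ A A)
    (a : ℂ) : ∀ (k : ℕ) (Q : A), (⇑D)^[k] (a • Q) = a • (⇑D)^[k] Q
  | 0, Q => rfl
  | k + 1, Q => by
    rw [Function.iterate_succ_apply, Function.iterate_succ_apply, Derivation.map_smul,
      derivation_iterate_smul D a k]

/-- `(a D)^k = a^k D^k`. -/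
theorem smul_derivation_iterate {A : Type*} [CommRing A] [Algebra ℂ A] (D : Derivation ℂ A A)
    (a : ℂ) : ∀ (k : ℕ) (Q : A), (⇑(a • D))^[k] Q = a ^ k • (⇑D)^[k] Q
  | 0, Q => by simp
  | k + 1, Q => by
    rw [Function.iterate_succ_apply, Function.iterate_succ_apply, Derivation.smul_apply,
      smul_derivation_iterate D a k, derivation_iterate_smul, smul_smul, ← pow_succ]

/-- Vanishing of the iterates `D_{w₀}^k P`, `k < N`, at `g` gives order `≥ N` along `exp(ℂ w₀)`
(the other directions `a w₀ ∈ W` only rescale: `D_{a w₀}^k = a^k D_{w₀}^k`). -/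
theorem vanishesToOrder_royLine_of {P : MvPolynomial (Fin 2) ℂ} {g : GaGm 1} {N : ℕ}
    (h : ∀ k < N, evalAt ((invDeriv ((1 : ℂ), (1 : Fin 1 → ℂ)))^[k] P) g = 0) :
    VanishesToOrder P (ℂ ∙ ((1 : ℂ), (1 : Fin 1 → ℂ))) g N := by
  rw [vanishesToOrder_iff_invDeriv]
  intro k hk u hu
  obtain ⟨a, rfl⟩ := mem_royLine.mp hu
  have h0 := h k hk
  rw [evalAt] at h0 ⊢
  rw [invDeriv_smul, smul_derivation_iterate, smul_eval, h0, mul_zero]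

/-- Roy's `D = ∂₀ + X₁∂₁` is the invariant derivation `D_{w₀}` after base change to `ℂ`. -/
theorem map_royD (P : MvPolynomial (Fin 2) ℤ) :
    map (Int.castRingHom ℂ) (royD P) =
      invDeriv ((1 : ℂ), (1 : Fin 1 → ℂ)) (map (Int.castRingHom ℂ) P) := by
  rw [invDeriv_apply, royD, map_add, map_mul, map_X, ← pderiv_map, ← pderiv_map]
  simp

/-- `D^k` after base change is `D_{w₀}^k`. -/
theorem map_royD_iterate (P : MvPolynomial (Fin 2) ℤ) (k : ℕ) :
    map (Int.castRingHom ℂ) (royD^[k] P) =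
      (invDeriv ((1 : ℂ), (1 : Fin 1 → ℂ)))^[k] (map (Int.castRingHom ℂ) P) := by
  induction k generalizing P with
  | zero => rfl
  | succ k ih => rw [Function.iterate_succ_apply, Function.iterate_succ_apply, ih, map_royD]

/-- Evaluating the base change of `Q ∈ ℤ[X₀,X₁]` at `g ∈ G(ℂ)` is `aeval (coord g) Q`. -/
theorem evalAt_map_int (Q : MvPolynomial (Fin 2) ℤ) (g : GaGm 1) :
    evalAt (map (Int.castRingHom ℂ) Q) g = aeval (coord g) Q := by
  rw [evalAt, eval_map, aeval_def, algebraMap_int_eq]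

end Summit.Schanuel.Schanuel.Theorems
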